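import Mathlib
import HarnessLib
import Summits.NavierStokesRegularity.NavierStokesRegularity.Theorems.PoloidalWindowDoorLrcModEntireQ4LineTools
import Summits.NavierStokesRegularity.NavierStokesRegularity.Theorems.PoloidalWindowDoorLrcModEntireQ4LineWeb
import Summits.NavierStokesRegularity.NavierStokesRegularity.Theorems.PoloidalWindowDoorLrcModEntireParallelWebs
import Summits.NavierStokesRegularity.NavierStokesRegularity.Theorems.PoloidalWindowDoorLrcModEntireSheetFlatten
import Summits.NavierStokesRegularity.NavierStokesRegularity.Theorems.PoloidalWindowDoorLrcModEntireHorizontalGerm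
import Summits.NavierStokesRegularity.NavierStokesRegularity.Theorems.PoloidalWindowDoorLrcModEntireRidgeWebLawHoriz
import Summits.NavierStokesRegularity.NavierStokesRegularity.Theorems.PoloidalWindowDoorLrcModEntireTwistingTHSlopeSign
import Summits.NavierStokesRegularity.NavierStokesRegularity.Theorems.LocalSineTubeDoorProfileAlignedWindowRigidityAncient

/-!
# Route `PoloidalWindowDoor`, item `LrcModEntire` (stmt-NavierStokesRegularity-20428) — CELL (Q4-LINE) OF THE (TH) COLUMN, CORE THEOREM

Cell ns-regularity-ideate, LEAD-lineage seat ns-poloidal-K2-p3 g16 (`--supports stmt-NavierStokesRegularity-20428`; memo `Cruxes/LrcModEntire/T2B-g16.md`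
«TRANSVERSAL RIGIDITY OF THE HOMOGENEOUS WEB»).  `q4line_core` takes the conjuncts of the registered stub `stub_Q4line` (skeleton twist_split v9, KEY #310-Q4)
that the proof uses (the verbatim-stub wrapper is `…Q4Line.stub_Q4line_closed`) and proves `False`: frame of the straight branch and the `C^ω` web function
(`…Q4LineWeb`); `∇ₕU₂ = 0` at web points (`…RidgeWebLaw.webData_of_fderiv_uncurry`), horizontal ridge law constant along web curves
(`…RidgeWebLawHoriz.horizLaplacian_two_eq_of_webFermat`), slice law (`…TimeHeightShearLinearSlice.plane_wave_identity`), `κ(0) ≥ κ > 0`, `μ(−1,0) ≤ 0`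
(`…TwistingTHSlopeSign.slopeFunction_nonpos`) on a window `|z| < δ₁`; PARALLEL WEBS (`…ParallelWebs.parallelWebs`); NON-SONIC ⇒ some height is non-characteristic
(Huygens + `…Q4LineTools.affine_on_window_of_deriv_deriv_eq_zero`); Cauchy–Kovalevskaya uniqueness across the sheet (`…SheetFlatten.fderiv_apply_eq_zero_on_slab`),
identity theorem, vorticity translation germ (`…HorizontalGerm.false_of_horizontalDeriv_two_eq_zero`).

WHAT THIS IS NOT: not a claim about Navier–Stokes regularity — one research sub-cell of the (TH) column of line twist_split closes; (Q4-curved), (Q4-sonic),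
T2b-flat, C2a′, C2b′, the wall ⟨27893⟩ and items 20428 / 19708 stay OPEN (bears_on LADDER-NS N0).
-/

noncomputable section

set_option linter.dupNamespace false
set_option linter.unusedVariables false

namespace Summit.NavierStokesRegularity.NavierStokesRegularity.Theorems.PoloidalWindowDoorLrcModEntireQ4LineCore

open Set Function Filter Topology Metric
open scoped RealInnerProductSpace InnerProductSpace Laplacian ContDiff
open Literature.Analysis Literature.Analysis.FluidPDE Literature.Analysis.UnboundedOperators
open Summit.NavierStokesRegularity.NavierStokesRegularity.Theorems.PoloidalWindowDoorLrcModEntireSheetCauchyUniqueness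
open Summit.NavierStokesRegularity.NavierStokesRegularity.Theorems.PoloidalWindowDoorLrcModEntireSheetFlattenTools
open Summit.NavierStokesRegularity.NavierStokesRegularity.Theorems.PoloidalWindowDoorLrcModEntireSheetFlatten
open Summit.NavierStokesRegularity.NavierStokesRegularity.Theorems.PoloidalWindowDoorLrcModEntireQ4LineTools
open Summit.NavierStokesRegularity.NavierStokesRegularity.Theorems.PoloidalWindowDoorLrcModEntireQ4LineWeb
open Summit.NavierStokesRegularity.NavierStokesRegularity.Theorems.PoloidalWindowDoorLrcModEntireParallelWebsIdentity
open Summit.NavierStokesRegularity.NavierStokesRegularity.Theorems.PoloidalWindowDoorLrcModEntireParallelWebs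
open Summit.NavierStokesRegularity.NavierStokesRegularity.Theorems.PoloidalWindowDoorLrcModEntireHorizontalGerm
open Summit.NavierStokesRegularity.NavierStokesRegularity.Theorems.PoloidalWindowDoorLrcModEntireRidgeWebLaw
open Summit.NavierStokesRegularity.NavierStokesRegularity.Theorems.PoloidalWindowDoorLrcModEntireRidgeWebLawHoriz
open Summit.NavierStokesRegularity.NavierStokesRegularity.Theorems.PoloidalWindowDoorPoloidalWindowRigidityTimeHeightShearLinearSlice
open Summit.NavierStokesRegularity.NavierStokesRegularity.Theorems.PoloidalWindowDoorPoloidalWindowRigidityConstantShearSlice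
open Summit.NavierStokesRegularity.NavierStokesRegularity.Theorems.PoloidalWindowDoorLrcModEntireTwistingTHSlopeSign
open Summit.NavierStokesRegularity.NavierStokesRegularity.Theorems.LocalSineTubeDoorProfileAlignedWindowRigidityAncient

/-- **CELL (Q4-LINE) OF THE (TH) COLUMN IS EMPTY — core form.**  Hypotheses = the conjuncts of the (Q4) package (skeleton twist_split v9, stub `stub_Q4line`)
that the proof uses, with `F = fun τ y => σ·U₂(−1+τ, y)` substituted; plus the sub-cell literals: `Γ` is the line `s ↦ s·Γ′(0)` and `R(0,·)` is not affine on `(−δ,δ)`. -/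
theorem q4line_core {C : ℝ} {U : ℝ → EuclideanSpace ℝ (Fin 3) → EuclideanSpace ℝ (Fin 3)} {Γ νΓ : ℝ → EuclideanSpace ℝ (Fin 3)} {R μ : ℝ → ℝ → ℝ}
    {σ κ r δ ρ : ℝ}
    (hUrate : HasTypeITimeDecay C U) (hUcont : ContinuousOn (uncurry U) (Iio (0 : ℝ) ×ˢ univ))
    (hUmild : ∀ s t : ℝ, s < t → t < 0 → ∀ x, U t x = heatExtension (U s) (t - s) x - oseenDuhamel 1 s U U t x)
    (hUdiv : ∀ t < 0, VectorCalculus.IsDivFree (U t))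
    (hUpol : ∀ s < 0, ∀ q, ⟪curl (U s) q, EuclideanSpace.single 2 1⟫_ℝ = 0)
    (hUne : U (-1) 0 2 ≠ 0) (hUhotbd : ∀ t < 0, ∀ x, Real.sqrt (-t) * |U t x 2| ≤ |U (-1) 0 2|)
    (hσ : σ = 1 ∨ σ = -1) (hσN : σ * U (-1) 0 2 = |U (-1) 0 2|) (hκ : 0 < κ)
    (hΓ0 : Γ 0 = 0) (hΓ2 : ∀ s, Γ s 2 = 0) (hΓunit : ∀ s, ‖deriv Γ s‖ = 1) (hΓhot : ∀ s, U (-1) (Γ s) 2 = U (-1) 0 2)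
    (hν : ∀ s, νΓ s = WithLp.toLp 2 ![-(deriv Γ s 1), deriv Γ s 0, 0])
    (hΓcurv : ∀ s, κ ≤ -(fderiv ℝ (fderiv ℝ (fun y => σ * U (-1) y 2)) (Γ s) (νΓ s) (νΓ s)))
    (hr : 0 < r) (hδ : 0 < δ)
    (hconc : ∀ τ z : ℝ, |τ| < δ → |z| < δ → ∀ s : ℝ, ∀ n ∈ Ioo (-r) r,
      fderiv ℝ (fderiv ℝ (fun y => σ * U (-1 + τ) y 2)) (Γ s + n • νΓ s + z • EuclideanSpace.single 2 (1 : ℝ)) (νΓ s) (νΓ s) < 0)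
    (hweb : ∀ τ₀ z₀ : ℝ, |τ₀| < δ → |z₀| < δ → ∀ s₀ : ℝ, ∃ n₀ ∈ Ioo (-r) r,
      σ * U (-1 + τ₀) (Γ s₀ + n₀ • νΓ s₀ + z₀ • EuclideanSpace.single 2 (1 : ℝ)) 2 = R τ₀ z₀ ∧
      (∀ n ∈ Icc (-r) r, n ≠ n₀ → σ * U (-1 + τ₀) (Γ s₀ + n • νΓ s₀ + z₀ • EuclideanSpace.single 2 (1 : ℝ)) 2 < R τ₀ z₀) ∧
      DifferentiableAt ℝ (uncurry R) (τ₀, z₀) ∧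
      fderiv ℝ (uncurry fun τ y => σ * U (-1 + τ) y 2) (τ₀, Γ s₀ + n₀ • νΓ s₀ + z₀ • EuclideanSpace.single 2 (1 : ℝ)) =
        (fderiv ℝ (uncurry R) (τ₀, z₀)).comp
          ((ContinuousLinearMap.fst ℝ ℝ (EuclideanSpace ℝ (Fin 3))).prod
            ((EuclideanSpace.proj (2 : Fin 3)).comp (ContinuousLinearMap.snd ℝ ℝ (EuclideanSpace ℝ (Fin 3))))))
    (hρ : 0 < ρ) (hμ3 : ContDiff ℝ 3 (uncurry μ))
    (hslabU : ∀ t : ℝ, |t + 1| < ρ → ∀ x : EuclideanSpace ℝ (Fin 3), |x 2| < ρ → ∀ b : Fin 3, b ≠ 2 →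
      fderiv ℝ (U t) x (EuclideanSpace.single 2 1) b = μ t (x 2) * fderiv ℝ (U t) x (EuclideanSpace.single b 1) 2)
    (hevU : ∀ t₀ : ℝ, |t₀ + 1| < ρ → ∀ y₀ : EuclideanSpace ℝ (Fin 3), y₀ 2 = 0 →
      ∀ᶠ z in 𝓝 ((t₀, y₀) : ℝ × EuclideanSpace ℝ (Fin 3)), ∀ b : Fin 3, b ≠ 2 →
        fderiv ℝ (U z.1) z.2 (EuclideanSpace.single 2 1) b = μ z.1 (z.2 2) * fderiv ℝ (U z.1) z.2 (EuclideanSpace.single b 1) 2)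
    (hline : ∀ s : ℝ, Γ s = s • deriv Γ 0) (hnson : ¬ (∃ a b : ℝ, ∀ z : ℝ, |z| < δ → R 0 z = a + b * z)) : False := by
  have hm1 : (-1 : ℝ) < 0 := by norm_num
  have h0δ : |(0 : ℝ)| < δ := by simpa using hδ
  obtain ⟨hΓd, he2, hunit, hνe, hpt⟩ := line_frame hline hΓ2 hΓunit hν
  set e : EuclideanSpace ℝ (Fin 3) := deriv Γ 0 with he_def
  have he0 : e ≠ 0 := by
    intro h; rw [h] at hunit; simp at hunit
  /- STEP 2: the signed component `F₀ = σU₂(−1,·)`, real-analytic. -/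
  obtain ⟨F₀, hF₀_def⟩ : ∃ F₀ : EuclideanSpace ℝ (Fin 3) → ℝ, F₀ = fun y => σ * U (-1) y 2 := ⟨_, rfl⟩
  have hUan : AnalyticOnNhd ℝ (U (-1)) univ := analyticOnNhd_slice hUcont (bdd_of_hasTypeITimeDecay hUrate) hUmild hm1
  have hU2 : ContDiff ℝ 2 (U (-1)) := hUan.contDiff
  have hUd : Differentiable ℝ (U (-1)) := hU2.differentiable (by norm_num)
  have hθan : AnalyticOnNhd ℝ (fun y => U (-1) y 2) univ := fun x _ =>
    ((EuclideanSpace.proj (𝕜 := ℝ) (2 : Fin 3)).analyticAt _).comp (hUan x (mem_univ _))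
  have hθ2 : ContDiff ℝ 2 (fun y => U (-1) y 2) := hθan.contDiff
  have hF₀an : AnalyticOnNhd ℝ F₀ univ := by
    rw [hF₀_def]; exact fun x hx => analyticAt_const.mul (hθan x hx)
  have hF₀ω : ContDiff ℝ ω F₀ := hF₀an.contDiff
  have hF₀3 : ContDiff ℝ 3 F₀ := hF₀an.contDiff
  have hF₀2 : ContDiff ℝ 2 F₀ := hF₀an.contDiff
  have hF₀d : Differentiable ℝ F₀ := hF₀2.differentiable (by norm_num)
  have hD2ω : ContDiff ℝ ω (fderiv ℝ (fderiv ℝ F₀)) :=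
    (hF₀ω.fderiv_right (m := ω) le_rfl).fderiv_right (m := ω) le_rfl
  have hF₀fd : ∀ x w, fderiv ℝ F₀ x w = σ * fderiv ℝ (fun y => U (-1) y 2) x w := by
    intro x w; rw [hF₀_def, fderiv_const_mul ((hθ2.differentiable (by norm_num)) x)]; simp
  have hS : ∀ z : ℝ, |z| < δ → ∀ s : ℝ, ∃ n₀ ∈ Ioo (-r) r, F₀ (frameCLM e (s, n₀, z)) = R 0 z ∧
      ∀ n ∈ Icc (-r) r, n ≠ n₀ → F₀ (frameCLM e (s, n, z)) < R 0 z := by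
    intro z hz s
    obtain ⟨n₀, hn₀, hval, huniq, -, -⟩ := hweb 0 z h0δ hz s
    simp only [add_zero] at hval huniq
    refine ⟨n₀, hn₀, ?_, fun n hn hne => ?_⟩
    · rw [hF₀_def, ← hpt]; exact hval
    · rw [hF₀_def, ← hpt]; exact huniq n hn hne
  set G : ℝ × ℝ → ℝ := webFun F₀ e r δ (R 0) hS with hG_def
  have hspec : ∀ p : ℝ × ℝ, |p.2| < δ → G p ∈ Ioo (-r) r ∧ F₀ (frameCLM e (p.1, G p, p.2)) = R 0 p.2 ∧
      ∀ n ∈ Icc (-r) r, n ≠ G p → F₀ (frameCLM e (p.1, n, p.2)) < R 0 p.2 := fun p hp => webFun_spec hS hp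
  have hWpt : ∀ p : ℝ × ℝ, webMap e G p = frameCLM e (p.1, G p, p.2) := fun p => by
    simp only [webMap, frameCLM_apply]
  have hW2 : ∀ p : ℝ × ℝ, webMap e G p 2 = p.2 := fun p => by rw [hWpt, frameCLM_apply_two he2]
  have hAweb : ∀ p : ℝ × ℝ, |p.2| < δ → DifferentiableAt ℝ (uncurry R) (0, p.2) ∧
      fderiv ℝ (uncurry fun τ y => σ * U (-1 + τ) y 2) (0, webMap e G p) =
        (fderiv ℝ (uncurry R) (0, p.2)).comp ((ContinuousLinearMap.fst ℝ ℝ (EuclideanSpace ℝ (Fin 3))).prod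
          ((EuclideanSpace.proj (2 : Fin 3)).comp (ContinuousLinearMap.snd ℝ ℝ (EuclideanSpace ℝ (Fin 3))))) := by
    intro p hp
    obtain ⟨n₁, hn₁, hval₁, -, hRd, hfd⟩ := hweb 0 p.2 h0δ hp p.1
    have hn : n₁ = G p := by
      by_contra hne
      have hlt := (hspec p hp).2.2 n₁ (Ioo_subset_Icc_self hn₁) hne
      simp only [add_zero] at hval₁
      rw [hpt] at hval₁
      simp only [hF₀_def] at hlt
      exact absurd hval₁ hlt.ne
    refine ⟨hRd, ?_⟩
    rw [hpt, hn] at hfd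
    rw [hWpt]; exact hfd
  have hgrad : ∀ p : ℝ × ℝ, |p.2| < δ → fderiv ℝ (U (-1)) (webMap e G p) (EuclideanSpace.single 0 1) 2 = 0 ∧
      fderiv ℝ (U (-1)) (webMap e G p) (EuclideanSpace.single 1 1) 2 = 0 := by
    intro p hp
    have h := webData_of_fderiv_uncurry hUrate hUcont hUmild hUdiv hσ (τ₀ := 0) (by norm_num) (hAweb p hp).2 (hAweb p hp).2 rfl
    simp only [add_zero] at h
    exact ⟨h.2.2.2.1, h.2.2.2.2.1⟩
  have hhoriz : ∀ p : ℝ × ℝ, |p.2| < δ → ∀ w : EuclideanSpace ℝ (Fin 3), w 2 = 0 →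
      fderiv ℝ (fun y => U (-1) y 2) (webMap e G p) w = 0 := fun p hp w hw =>
    fderiv_two_horizontal_eq_zero (hUd _) (hgrad p hp).1 (hgrad p hp).2 hw
  /- STEP 4: `G(s,0) = 0` (hot value on `Γ`, hot bound). -/
  have hF₀le : ∀ x, F₀ x ≤ σ * U (-1) 0 2 := by
    intro x
    have h1 : F₀ x ≤ |U (-1) x 2| := by
      rw [hF₀_def]; simp only
      rcases hσ with h | h
      · rw [h, one_mul]; exact le_abs_self _
      · rw [h, neg_one_mul]; exact neg_le_abs _
    have h2 := hUhotbd (-1) hm1 x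
    rw [neg_neg, Real.sqrt_one, one_mul] at h2
    rw [hσN]
    exact h1.trans h2
  have hF₀Γ : ∀ s, F₀ (frameCLM e (s, 0, 0)) = σ * U (-1) 0 2 := by
    intro s
    rw [← hpt s 0 0, zero_smul, zero_smul, add_zero, add_zero, hF₀_def]
    simp only; rw [hΓhot s]
  have hG0 : ∀ s : ℝ, G (s, 0) = 0 := by
    intro s
    have hp : |((s, (0 : ℝ)) : ℝ × ℝ).2| < δ := by simpa using hδ
    obtain ⟨-, hval, huniq⟩ := hspec (s, 0) hp
    by_contra hne
    have hlt := huniq 0 ⟨by linarith [hr], by linarith [hr]⟩ (Ne.symm hne)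
    simp only at hlt hval
    rw [hF₀Γ] at hlt
    linarith [hF₀le (frameCLM e (s, G (s, 0), 0))]
  have hW00 : webMap e G ((0 : ℝ), 0) = 0 := by
    rw [hWpt]; simp only; rw [hG0 0]; simp [frameCLM_apply]
  /- STEP 5: strict concavity along `ν = Je`; the web function is `C^ω` on `|z| < δ`. -/
  have hconcF : ∀ z : ℝ, |z| < δ → ∀ s : ℝ, ∀ n ∈ Ioo (-r) r,
      fderiv ℝ (fderiv ℝ F₀) (frameCLM e (s, n, z)) (Jvec e) (Jvec e) < 0 := by
    intro z hz s n hn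
    have h := hconc 0 z h0δ hz s n hn
    simp only [add_zero] at h
    rw [← hF₀_def, hpt, hνe] at h
    exact h
  have hGω : ∀ p : ℝ × ℝ, |p.2| < δ → ContDiffAt ℝ ω G p := fun p hp => contDiffAt_webFun hF₀ω hS hconcF hp
  have hWω : ∀ p : ℝ × ℝ, |p.2| < δ → ContDiffAt ℝ ω (webMap e G) p := by
    intro p hp
    unfold webMap
    exact ((contDiffAt_fst.smul contDiffAt_const).add ((hGω p hp).smul contDiffAt_const)).add
      (contDiffAt_snd.smul contDiffAt_const)
  set d : ℝ → ℝ := fun z => G (0, z) with hd_def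
  have hdω : ∀ z : ℝ, |z| < δ → ContDiffAt ℝ ω d z := fun z hz =>
    (hGω ((0 : ℝ), z) hz).comp z (contDiffAt_const.prodMk contDiffAt_id)
  have hW0ω : ∀ z : ℝ, |z| < δ → ContDiffAt ℝ ω (fun z : ℝ => webMap e G ((0 : ℝ), z)) z := fun z hz =>
    (hWω ((0 : ℝ), z) hz).comp z (contDiffAt_const.prodMk contDiffAt_id)
  have hRω : ∀ z : ℝ, |z| < δ → ContDiffAt ℝ ω (R 0) z := by
    intro z hz
    refine ((hF₀ω.contDiffAt).comp z (hW0ω z hz)).congr_of_eventuallyEq ?_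
    filter_upwards [(isOpen_lt continuous_abs continuous_const).mem_nhds (hz : z ∈ {z' : ℝ | |z'| < δ})] with z' hz'
    rw [Function.comp_apply, hWpt]; exact ((hspec (0, z') hz').2.1).symm
  have habs : ∀ z : ℝ, z ∈ Ioo (-δ) δ ↔ |z| < δ := fun z => by rw [mem_Ioo, abs_lt]
  have hRon : ContDiffOn ℝ ω (R 0) (Ioo (-δ) δ) := fun z hz => (hRω z ((habs z).1 hz)).contDiffWithinAt
  have hR1on : ContDiffOn ℝ 2 (deriv (R 0)) (Ioo (-δ) δ) :=
    ((contDiffOn_succ_iff_deriv_of_isOpen isOpen_Ioo).1 (hRon.of_le (m := 2 + 1) le_top)).2.2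
  have hR2on : ContDiffOn ℝ 1 (deriv (deriv (R 0))) (Ioo (-δ) δ) :=
    ((contDiffOn_succ_iff_deriv_of_isOpen isOpen_Ioo).1 (hR1on.of_le (m := 1 + 1) (by norm_num))).2.2
  have hdon : ContDiffOn ℝ ω d (Ioo (-δ) δ) := fun z hz => (hdω z ((habs z).1 hz)).contDiffWithinAt
  have hd1on : ContDiffOn ℝ 2 (deriv d) (Ioo (-δ) δ) :=
    ((contDiffOn_succ_iff_deriv_of_isOpen isOpen_Ioo).1 (hdon.of_le (m := 2 + 1) le_top)).2.2
  have hRd : ∀ z ∈ Ioo (-δ) δ, DifferentiableAt ℝ (R 0) z := fun z hz => (hRω z ((habs z).1 hz)).differentiableAt (by simp)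
  have hR'd : ∀ z ∈ Ioo (-δ) δ, DifferentiableAt ℝ (deriv (R 0)) z := fun z hz =>
    ((hR1on.differentiableOn (by norm_num)) z hz).differentiableAt (isOpen_Ioo.mem_nhds hz)
  have hR''d : ∀ z ∈ Ioo (-δ) δ, DifferentiableAt ℝ (deriv (deriv (R 0))) z := fun z hz =>
    ((hR2on.differentiableOn (by norm_num)) z hz).differentiableAt (isOpen_Ioo.mem_nhds hz)
  /- STEP 7: the slope function at `t = −1`: `C¹`, `μ(−1,0) ≤ 0`. -/
  have hμfun : μ (-1) = uncurry μ ∘ fun z : ℝ => ((-1 : ℝ), z) := by funext z; rfl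
  have hμd : ∀ z : ℝ, DifferentiableAt ℝ (μ (-1)) z := fun z => by
    rw [hμfun]; exact ((hμ3.differentiable (by norm_num)) _).comp z ((differentiableAt_const _).prodMk differentiableAt_id)
  have hμc : Continuous (μ (-1)) := by
    rw [hμfun]; exact hμ3.continuous.comp (continuous_const.prodMk continuous_id)
  have hslabU1 : ∀ x : EuclideanSpace ℝ (Fin 3), |x 2| < ρ → ∀ b : Fin 3, b ≠ 2 →
      fderiv ℝ (U (-1)) x (EuclideanSpace.single 2 1) b = μ (-1) (x 2) * fderiv ℝ (U (-1)) x (EuclideanSpace.single b 1) 2 :=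
    fun x hx b hb => hslabU (-1) (by simp [hρ]) x hx b hb
  have hplane : ∀ z : ℝ, |z| < ρ → ∀ y : EuclideanSpace ℝ (Fin 3), y 2 = z → ∀ b : Fin 3, b ≠ 2 →
      fderiv ℝ (U (-1)) y (EuclideanSpace.single 2 (1 : ℝ)) b = μ (-1) z * fderiv ℝ (U (-1)) y (EuclideanSpace.single b (1 : ℝ)) 2 := by
    intro z hz y hy b hb
    have h := hslabU1 y (by rw [hy]; exact hz) b hb
    rw [hy] at h; exact h
  have hμle : μ (-1) 0 ≤ 0 :=
    slopeFunction_nonpos hUrate hUcont hUmild hUdiv hUpol hUne hUhotbd hμ3.continuous (hevU (-1) (by simp [hρ]) 0 rfl)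
  /- STEP 8: frame form of the horizontal Laplacian and the slice law for `F₀`. -/
  have hframe : ∀ x : EuclideanSpace ℝ (Fin 3),
      fderiv ℝ (fderiv ℝ F₀) x e e + fderiv ℝ (fderiv ℝ F₀) x (Jvec e) (Jvec e) =
        σ * (fderiv ℝ (fun w => fderiv ℝ (fun y => U (-1) y 2) w (EuclideanSpace.single 0 (1 : ℝ))) x (EuclideanSpace.single 0 (1 : ℝ)) +
          fderiv ℝ (fun w => fderiv ℝ (fun y => U (-1) y 2) w (EuclideanSpace.single 1 (1 : ℝ))) x (EuclideanSpace.single 1 (1 : ℝ))) := by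
    intro x
    rw [bilin_frame_trace (fderiv ℝ (fderiv ℝ F₀) x) he2 hunit, ← nested_eq_fderiv_fderiv hF₀2, ← nested_eq_fderiv_fderiv hF₀2,
      hF₀_def, nested_const_mul hθ2, nested_const_mul hθ2]
    ring
  have hslice₀ : ∀ x : EuclideanSpace ℝ (Fin 3), |x 2| < ρ →
      fderiv ℝ (fderiv ℝ F₀) x e2 e2 =
        -μ (-1) (x 2) * (fderiv ℝ (fderiv ℝ F₀) x e e + fderiv ℝ (fderiv ℝ F₀) x (Jvec e) (Jvec e)) := by
    intro x hx
    have hpw := plane_wave_identity hU2 (fun y => div_coord (hUdiv (-1) hm1) y) (hplane (x 2) hx) (x := x) rfl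
    rw [hframe, ← nested_eq_fderiv_fderiv hF₀2, hF₀_def, show e2 = EuclideanSpace.single 2 (1 : ℝ) from rfl,
      nested_const_mul hθ2, hpw]
    ring
  /- STEP 9: the curvature function `κ(z) = −ΔₕF₀` on the web, the height window `δ₁`. -/
  obtain ⟨κf, hκf_def⟩ : ∃ κf : ℝ → ℝ, κf = fun z => -(fderiv ℝ (fderiv ℝ F₀) (webMap e G ((0 : ℝ), z)) e e +
      fderiv ℝ (fderiv ℝ F₀) (webMap e G ((0 : ℝ), z)) (Jvec e) (Jvec e)) := ⟨_, rfl⟩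
  have hκfd : ∀ z : ℝ, |z| < δ → DifferentiableAt ℝ κf z := by
    intro z hz
    have h1 : DifferentiableAt ℝ (fderiv ℝ (fderiv ℝ F₀) ∘ fun z : ℝ => webMap e G ((0 : ℝ), z)) z :=
      ((hD2ω.contDiffAt).comp z (hW0ω z hz)).differentiableAt (by simp)
    rw [hκf_def]
    exact ((h1.clm_apply (differentiableAt_const e)).clm_apply (differentiableAt_const e)).add
      ((h1.clm_apply (differentiableAt_const (Jvec e))).clm_apply (differentiableAt_const (Jvec e))) |>.neg
  have hκf0 : κ ≤ κf 0 := by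
    have hee : fderiv ℝ (fderiv ℝ F₀) 0 e e = 0 := by
      refine fderiv_fderiv_eq_zero_of_const_on_line hF₀2 e (c := σ * U (-1) 0 2) fun s => ?_
      rw [← hline s, hF₀_def]; simp only; rw [hΓhot s]
    have hνν := hΓcurv 0
    rw [hΓ0, hνe, ← hF₀_def] at hνν
    rw [hκf_def]; simp only; rw [hW00, hee, zero_add]
    exact hνν
  have hκpos0 : 0 < κf 0 := lt_of_lt_of_le hκ hκf0
  obtain ⟨ε, hε, hball⟩ : ∃ ε > 0, ∀ z : ℝ, |z| < ε → 0 < κf z ∧ μ (-1) z < 1 := by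
    have h1 : ∀ᶠ z in 𝓝 (0 : ℝ), 0 < κf z := (hκfd 0 h0δ).continuousAt.eventually_const_lt hκpos0
    have h2 : ∀ᶠ z in 𝓝 (0 : ℝ), μ (-1) z < 1 := (hμd 0).continuousAt.eventually_lt_const (by linarith)
    obtain ⟨ε, hε, h⟩ := Metric.eventually_nhds_iff.1 (h1.and h2)
    exact ⟨ε, hε, fun z hz => h (by simpa [Real.dist_eq] using hz)⟩
  set δ₁ : ℝ := min (min δ ρ) ε with hδ₁_def
  have hδ₁ : 0 < δ₁ := lt_min (lt_min hδ hρ) hε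
  have hI : ∀ z ∈ Ioo (-δ₁) δ₁, |z| < δ ∧ |z| < ρ ∧ 0 < κf z ∧ μ (-1) z < 1 := by
    intro z hz
    have hz' : |z| < δ₁ := abs_lt.2 hz
    have h1 : δ₁ ≤ δ := (min_le_left _ _).trans (min_le_left _ _)
    have h2 : δ₁ ≤ ρ := (min_le_left _ _).trans (min_le_right _ _)
    have h3 : δ₁ ≤ ε := min_le_right _ _
    exact ⟨lt_of_lt_of_le hz' h1, lt_of_lt_of_le hz' h2, hball z (lt_of_lt_of_le hz' h3)⟩
  have hIδ : Ioo (-δ₁) δ₁ ⊆ Ioo (-δ) δ := fun z hz => (habs z).2 (hI z hz).1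
  have hδ₁δ : δ₁ ≤ δ := (min_le_left _ _).trans (min_le_left _ _)
  /- STEP 10: the hypotheses of `parallelWebs` on the region `ℝ × (−δ₁, δ₁)`. -/
  have hG2 : ContDiffOn ℝ 2 G (region (Ioo (-δ₁) δ₁)) := fun p hp => ((hGω p (hI p.2 hp).1).of_le le_top).contDiffWithinAt
  have hGd : ∀ p ∈ region (Ioo (-δ₁) δ₁), DifferentiableAt ℝ G p := fun p hp => (hGω p (hI p.2 hp).1).differentiableAt (by simp)
  have hRhyp : ∀ z ∈ Ioo (-δ₁) δ₁, HasDerivAt (deriv (R 0)) (deriv (deriv (R 0)) z) z := fun z hz => (hR'd z (hIδ hz)).hasDerivAt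
  have hR1hyp : ∀ z ∈ Ioo (-δ₁) δ₁, DifferentiableAt ℝ (R 0) z := fun z hz => hRd z (hIδ hz)
  have hκhyp : ∀ z ∈ Ioo (-δ₁) δ₁, 0 < κf z := fun z hz => (hI z hz).2.2.1
  have hκdhyp : ∀ z ∈ Ioo (-δ₁) δ₁, DifferentiableAt ℝ κf z := fun z hz => hκfd z (hI z hz).1
  have hcdhyp : ∀ z ∈ Ioo (-δ₁) δ₁, DifferentiableAt ℝ (fun z => deriv (deriv (R 0)) z - μ (-1) z * κf z) z := fun z hz =>
    (hR''d z (hIδ hz)).sub ((hμd z).mul (hκfd z (hI z hz).1))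
  have hνhyp : ∀ p ∈ region (Ioo (-δ₁) δ₁), fderiv ℝ F₀ (webMap e G p) (Jvec e) = 0 := fun p hp => by
    rw [hWpt]; exact fderiv_Jvec_webFun_eq_zero hF₀d hS (hI p.2 hp).1
  have hehyp : ∀ p ∈ region (Ioo (-δ₁) δ₁), fderiv ℝ F₀ (webMap e G p) e = 0 := fun p hp => by
    rw [hF₀fd, hhoriz p (hI p.2 hp).1 e he2, mul_zero]
  have hvalhyp : ∀ p ∈ region (Ioo (-δ₁) δ₁), F₀ (webMap e G p) = R 0 p.2 := fun p hp => by
    rw [hWpt]; exact (hspec p (hI p.2 hp).1).2.1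
  have hridge : ∀ p ∈ region (Ioo (-δ₁) δ₁), fderiv ℝ (fderiv ℝ F₀) (webMap e G p) e e +
      fderiv ℝ (fderiv ℝ F₀) (webMap e G p) (Jvec e) (Jvec e) = -κf p.2 := by
    intro p hp
    obtain ⟨hzδ, hzρ, -, hμ1⟩ := hI p.2 hp
    have hzδ' : |((0 : ℝ), p.2).2| < δ := hzδ
    have hO : IsOpen ({q : ℝ × EuclideanSpace ℝ (Fin 3) | |q.1 + 1| < ρ} ∩ {q | |q.2 2| < ρ}) :=
      (isOpen_lt (continuous_abs.comp (continuous_fst.add continuous_const)) continuous_const).inter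
        (isOpen_lt (continuous_abs.comp ((EuclideanSpace.proj (𝕜 := ℝ) (2 : Fin 3)).continuous.comp continuous_snd))
          continuous_const)
    have hslopeEv : ∀ y : EuclideanSpace ℝ (Fin 3), y 2 = (webMap e G p) 2 →
        ∀ᶠ q in 𝓝 ((-1 + 0, y) : ℝ × EuclideanSpace ℝ (Fin 3)), ∀ b : Fin 3, b ≠ 2 →
          fderiv ℝ (U q.1) q.2 (EuclideanSpace.single 2 1) b = μ q.1 (q.2 2) * fderiv ℝ (U q.1) q.2 (EuclideanSpace.single b 1) 2 := by
      intro y hy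
      have hmem : ((-1 + 0 : ℝ), y) ∈ ({q : ℝ × EuclideanSpace ℝ (Fin 3) | |q.1 + 1| < ρ} ∩ {q | |q.2 2| < ρ}) := by
        refine ⟨by simp [hρ], ?_⟩
        show |y 2| < ρ
        rw [hy, hW2]; exact hzρ
      exact Filter.eventually_of_mem (hO.mem_nhds hmem) fun q hq => hslabU q.1 hq.1 q.2 hq.2
    have hplane' : ∀ y : EuclideanSpace ℝ (Fin 3), y 2 = (webMap e G p) 2 → ∀ b : Fin 3, b ≠ 2 →
        fderiv ℝ (U (-1 + 0)) y (EuclideanSpace.single 2 1) b =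
          μ (-1 + 0) ((webMap e G p) 2) * fderiv ℝ (U (-1 + 0)) y (EuclideanSpace.single b 1) 2 := by
      intro y hy b hb
      rw [add_zero, hW2]
      exact hplane p.2 hzρ y (by rw [hy, hW2]) b hb
    have hμ1' : μ (-1 + 0) ((webMap e G p) 2) ≠ 1 := by rw [add_zero, hW2]; exact hμ1.ne
    have hvalEq : σ * U (-1 + 0) (webMap e G p) 2 = σ * U (-1 + 0) (webMap e G ((0 : ℝ), p.2)) 2 := by
      have h1 := hvalhyp p hp
      have h2 : F₀ (webMap e G ((0 : ℝ), p.2)) = R 0 p.2 := by rw [hWpt]; exact (hspec ((0 : ℝ), p.2) hzδ').2.1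
      rw [hF₀_def] at h1 h2
      simp only at h1 h2
      rw [add_zero, h1, h2]
    have h := horizLaplacian_two_eq_of_webFermat hUrate hUcont hUmild hUdiv hUpol hμ3 (τ₀ := 0) (by norm_num)
      (p := webMap e G p) (p' := webMap e G ((0 : ℝ), p.2)) (by rw [hW2, hW2]) hslopeEv hplane' hμ1' hσ
      (hAweb p hzδ).2 (hAweb ((0 : ℝ), p.2) hzδ').2 hvalEq
    simp only [add_zero] at h
    rw [hκf_def]; simp only
    rw [hframe, hframe, h, neg_neg]
  have hslice : ∀ p ∈ region (Ioo (-δ₁) δ₁), fderiv ℝ (fderiv ℝ F₀) (webMap e G p) e2 e2 =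
      -μ (-1) p.2 * (fderiv ℝ (fderiv ℝ F₀) (webMap e G p) e e + fderiv ℝ (fderiv ℝ F₀) (webMap e G p) (Jvec e) (Jvec e)) := by
    intro p hp
    have h := hslice₀ (webMap e G p) (by rw [hW2]; exact (hI p.2 hp).2.1)
    rw [hW2] at h; exact h
  have hpar : ∀ s : ℝ, ∀ z ∈ Ioo (-δ₁) δ₁, G (s, z) = G (0, z) :=
    parallelWebs hF₀3 e hδ₁ hG2 hRhyp hR1hyp hκhyp hκdhyp hcdhyp hνhyp hehyp hvalhyp hridge hslice hG0
  /- STEP 12: NON-SONIC — some height in `(−δ₁, δ₁)` is non-characteristic. -/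
  have hQ : ∃ z₀ ∈ Ioo (-δ₁) δ₁, deriv d z₀ ^ 2 + μ (-1) z₀ ≠ 0 := by
    by_contra hall
    push Not at hall
    apply hnson
    have hR'' : ∀ z ∈ Ioo (-δ₁) δ₁, deriv (deriv (R 0)) z = 0 := by
      intro z hz
      have hp : ((0 : ℝ), z) ∈ region (Ioo (-δ₁) δ₁) := hz
      have hH := huygens_identity hF₀3 e isOpen_Ioo hGd hRhyp hR1hyp hνhyp hehyp hvalhyp hridge hslice hp
      have hev : G =ᶠ[𝓝 ((0 : ℝ), z)] (d ∘ Prod.snd) := by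
        filter_upwards [(isOpen_region isOpen_Ioo).mem_nhds hp] with q hq
        have h := hpar q.1 q.2 hq
        rw [Prod.mk.eta] at h
        exact h
      have hdd : DifferentiableAt ℝ d z := (hdω z (hI z hz).1).differentiableAt (by simp)
      have hsnd : HasFDerivAt (Prod.snd : ℝ × ℝ → ℝ) (ContinuousLinearMap.snd ℝ ℝ ℝ) ((0 : ℝ), z) := hasFDerivAt_snd
      have hcomp : HasFDerivAt (d ∘ Prod.snd) ((fderiv ℝ d z).comp (ContinuousLinearMap.snd ℝ ℝ ℝ)) ((0 : ℝ), z) :=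
        hdd.hasFDerivAt.comp ((0 : ℝ), z) hsnd
      have hGz : fderiv ℝ G ((0 : ℝ), z) (0, 1) = deriv d z := by
        rw [hev.fderiv_eq, hcomp.fderiv]; simp
      have hGs : fderiv ℝ G ((0 : ℝ), z) (1, 0) = 0 := by
        rw [hev.fderiv_eq, hcomp.fderiv]; simp
      simp only at hH
      rw [hGz, hGs] at hH
      linear_combination (-1 : ℝ) * hH + κf z * hall z hz
    exact affine_on_window_of_deriv_deriv_eq_zero hδ₁ hδ₁δ hRω hR''
  obtain ⟨z₀, hz₀, hQz₀⟩ := hQ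
  /- STEP 13: the open set `J` of non-characteristic heights; CK uniqueness across the sheet. -/
  set J : Set ℝ := Ioo (-δ₁) δ₁ ∩ (fun z => deriv d z ^ 2 + μ (-1) z) ⁻¹' ({0}ᶜ) with hJ_def
  have hJsub : J ⊆ Ioo (-δ₁) δ₁ := inter_subset_left
  have hQc : ContinuousOn (fun z => deriv d z ^ 2 + μ (-1) z) (Ioo (-δ₁) δ₁) :=
    ((hd1on.continuousOn.mono hIδ).pow 2).add hμc.continuousOn
  have hJo : IsOpen J := hQc.isOpen_inter_preimage isOpen_Ioo isOpen_compl_singleton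
  have hz₀J : z₀ ∈ J := ⟨hz₀, hQz₀⟩
  have hdJ : ContDiffOn ℝ ∞ d J := fun z hz => ((hdω z (hI z (hJsub hz)).1).of_le le_top).contDiffWithinAt
  have hlawJ : ∀ x : EuclideanSpace ℝ (Fin 3), x 2 ∈ J →
      fderiv ℝ (fun y => fderiv ℝ (fun y' => U (-1) y' 2) y (EuclideanSpace.single 2 (1 : ℝ))) x (EuclideanSpace.single 2 (1 : ℝ)) =
        -μ (-1) (x 2) * (fderiv ℝ (fun y => fderiv ℝ (fun y' => U (-1) y' 2) y (EuclideanSpace.single 0 (1 : ℝ))) x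
            (EuclideanSpace.single 0 (1 : ℝ)) +
          fderiv ℝ (fun y => fderiv ℝ (fun y' => U (-1) y' 2) y (EuclideanSpace.single 1 (1 : ℝ))) x
            (EuclideanSpace.single 1 (1 : ℝ))) := fun x hx =>
    plane_wave_identity hU2 (fun y => div_coord (hUdiv (-1) hm1) y) (hplane (x 2) (hI _ (hJsub hx)).2.1) rfl
  have hwebJ : ∀ s : ℝ, ∀ z ∈ J, fderiv ℝ (fun y => U (-1) y 2) (s • e + d z • Jvec e + z • e2) e = 0 ∧
      fderiv ℝ (fun y => U (-1) y 2) (s • e + d z • Jvec e + z • e2) (Jvec e) = 0 := by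
    intro s z hz
    have hz' := hJsub hz
    have hpt' : s • e + d z • Jvec e + z • e2 = webMap e G (s, z) := by
      show s • e + G (0, z) • Jvec e + z • e2 = (s, z).1 • e + G (s, z) • Jvec e + (s, z).2 • e2
      rw [hpar s z hz']
    have hzδ : |((s, z) : ℝ × ℝ).2| < δ := (hI z hz').1
    rw [hpt']
    exact ⟨hhoriz (s, z) hzδ e he2, hhoriz (s, z) hzδ (Jvec e) (by simp [Jvec])⟩
  have hη : ∀ x : EuclideanSpace ℝ (Fin 3), x 2 ∈ J → fderiv ℝ (fun y => U (-1) y 2) x e = 0 :=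
    fderiv_apply_eq_zero_on_slab hθan hJo (μ := μ (-1)) (fun z _ => hμd z) hdJ he2 hunit hlawJ hwebJ (fun z hz => hz.2)
  /- STEP 14: `∂_eU₂(−1,·) ≡ 0` on `ℝ³` by analyticity; STEP 15: the vorticity translation germ ends it. -/
  have hη0 := fderiv_apply_eq_zero_of_slab hθan hJo hz₀J e hη
  exact false_of_horizontalDeriv_two_eq_zero hUrate hUcont hUmild hUdiv hUpol hρ hslabU1 he0 he2 (fun x _ => hη0 x) hUne

end Summit.NavierStokesRegularity.NavierStokesRegularity.Theorems.PoloidalWindowDoorLrcModEntireQ4LineCore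

end
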